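import Mathlib
import Literature.Analysis.FluidPDE.ElgindiSelfSimilarEquations
import HarnessLib
/-!
# The strain mode `Φ₀ = ℓ(z) sin 2θ` of Elgindi's `(z, θ)` gauge: closed forms of `U`, `V`, `𝓡`, the elliptic operator, and the
# transport coefficients of the class-E profile equation — the kernel side of the «ℓ-reduced» large-`δ` model of zone Z6

HONEST FRAMING (cell ns-blowup GROUP B «PROFILE SEARCH», zone Z6 «Elgindi-type C^{1,α} no-swirl self-similar blow-up»; human
rulings D-0035/D-0074/D-0081): calculus and real algebra about the ν = 0 axisymmetric NO-SWIRL **EULER** profile system of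
`Literature.Analysis.FluidPDE.Elgindi` (`opU`, `opV`, `opR`, `ellipticOp`, `IsProfile`). Not Navier–Stokes; «violates: none —
MODEL (Euler)». Nothing here asserts that a profile exists or computes `δ(α)`; the objects are the COEFFICIENTS of the profile
equation evaluated on ONE explicit family of stream functions, the strain mode `Φ₀(z, θ) = ℓ(z) sin 2θ` — the `m₊ = 0` part of the
`ℓ = 2` mode of the Biot–Savart inverse, `ℓ(z) = L₁₂(F)(z)/(4α)` in Elgindi's analysis ([Elgindi2021] §1.7: `Ψ = (4α)⁻¹ sin 2θ L₁₂(Ω)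
+ lower order`). Writing `ℓ′` for `dℓ/dz` (so `zℓ′ = dℓ/ds`, `s = ln z`) and `x = sin²θ`, the file KERNEL-CHECKS, directly against the
tree's operators:
* `opU_strainMode`: `U(Φ₀) = −(3ℓ + αzℓ′) sin 2θ`; `opV_strainMode`: `V(Φ₀) = 2ℓ(1 − 3x)` (`cos θ ≠ 0`);
  `opR_strainMode`: `𝓡(Φ₀) = 2ℓ + 2αzℓ′x` (`cos θ ≠ 0`);
* `ellipticOp_strainMode`: `E(Φ₀) = (−α²z²ℓ″ − α(5+α)zℓ′) sin 2θ` (`cos θ ≠ 0`) — the angular part of the elliptic operator KILLS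
  `sin 2θ` (`−(sin 2θ)″ + (tan θ sin 2θ)′ − 6 sin 2θ = (4 + 2 − 6) sin 2θ = 0`), which is why this mode carries the long-range
  (non-decaying, `m₊ = 0`) part of the stream function;
* `weightLogDeriv_E_mul_sin_two`: for Elgindi's class weight `Γ_E = (sin θ cos²θ)^{α/3}`, `sin 2θ · Γ_E′/Γ_E = (2α/3)(1 − 3x)`;
* `transportCoeff_c_strainMode` / `transportCoeff_a_strainMode` (pure algebra): in the transport form `a H_s + U H_θ = c H` of the
  class-E profile equation for `F = Γ_E z H` (Z6 ENGINE-B.md §D1′: `a = (1+δ) + αV`, `c = 𝓡 − 1 − a − UΓ′/Γ`) the strain mode gives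
  `a = (1+δ) + 2αℓ(1 − 3x)` and `c = (2ℓ − 2 − δ) + αzℓ′(2x + (2α/3)(1 − 3x))` — so apart from the local flux term `zℓ′`
  (`= −G/(4α)`, `G = ∫FK dθ`) the coefficient `c` is the θ-INDEPENDENT defect `2ℓ(z) − 2 − δ`, which vanishes at the corner by the
  corner law `ℓ(0) = A = 1 + δ/2` (`ElgindiGaugeCornerSpeed.cornerLaw_E_iff`);
* `transportCoeff_normalForm` (pure algebra): dividing by `1+δ` with `ℓ = (1+δ)λ`, `zℓ′ = (1+δ)μ` gives
  `c = (1+δ)(2(λ − λ₀) + αμ(2x + (2α/3)(1−3x)))`, `a = (1+δ)(1 + 2αλ(1−3x))` with `λ₀ = (2+δ)/(2(1+δ)) = (1 + 1/(1+δ))/2`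
  (`lambda0_eq`, written inline): **`δ` enters the reduced equation only through `λ₀`**, and `λ₀ → 1/2` as `δ → ∞` (`tendsto_lambda0_atTop`);
* `reversalLine_lt_half`, `reversalMargin_eq`, `tendsto_reversalLine_atTop`: the characteristic-reversal threshold
  `α_rev(δ) = (1+δ)/(2(2+δ))` of `ElgindiGaugeCornerSpeed.cornerSpeed_E_pos_iff` is `< 1/2` for every `δ > −2`, satisfies
  `(1+δ)(1/2 − α_rev(δ)) = (1+δ)/(2(2+δ))`, and tends to `1/2` as `δ → ∞` — the kernel reading behind the Z6-1 (c) census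
  sentence «the class-E branch can only leave through `c_l = (1+δ)/α → ∞` at `α_E → 1/2` while its corner stays pure inflow».
WHAT IS NOT PROVED: that `ℓ sin 2θ` IS the leading part of `Φ_F` for a profile (Elgindi's elliptic analysis, not vendored here); any
statement about solutions; the numerics of the reduced model (HOME/profile/z6twin/asym/, eng-10 g5 STATUS FINDING 2026-08-27).
PLACEMENT: cell-own MODEL/Euler-gauge lemma next to `ElgindiGaugeCornerSpeed` and `AxisModelExponentDictionary` (profile-eng-10);
bears on LADDER-NS N5 / zone Z6 → N1 linear core (engine custody: both Z6 engines' transport coefficients).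
-/

open Real Filter Topology

namespace Summit.NavierStokesRegularity.OSWSelfSimilar
namespace ElgindiStrainMode

open Literature.Analysis.FluidPDE

/-! The strain mode is written inline as the curried function `fun z θ => ℓ z * Real.sin (2 * θ)` throughout (no new
definition is introduced: this is a proof-only companion of `ElgindiGaugeCornerSpeed`). -/

/-! ### Slice derivatives of the strain mode -/

/-- `∂_z Φ₀ = ℓ′(z) sin 2θ`. [folklore] -/
theorem dz_strainMode {ℓ : ℝ → ℝ} {ℓ' z : ℝ} (hℓ : HasDerivAt ℓ ℓ' z) (θ : ℝ) :
    Elgindi.dz (fun z θ => ℓ z * Real.sin (2 * θ)) z θ = ℓ' * Real.sin (2 * θ) := by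
  unfold Elgindi.dz
  exact (hℓ.mul_const _).deriv

/-- `D_z Φ₀ = z ℓ′(z) sin 2θ`. [folklore] -/
theorem Dz_strainMode {ℓ : ℝ → ℝ} {ℓ' z : ℝ} (hℓ : HasDerivAt ℓ ℓ' z) (θ : ℝ) :
    Elgindi.Dz (fun z θ => ℓ z * Real.sin (2 * θ)) z θ = z * ℓ' * Real.sin (2 * θ) := by
  rw [Elgindi.Dz_eq_mul_dz, dz_strainMode hℓ, mul_assoc]

/-- The `θ`-slice of the strain mode has derivative `2ℓ(z) cos 2θ`. [folklore] -/
theorem hasDerivAt_strainMode_theta (ℓ : ℝ → ℝ) (z θ : ℝ) :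
    HasDerivAt (fun θ' => ℓ z * Real.sin (2 * θ')) (2 * ℓ z * Real.cos (2 * θ)) θ := by
  have h := (((hasDerivAt_id' θ).const_mul (2 : ℝ)).sin).const_mul (ℓ z)
  exact h.congr_deriv (by ring)

/-- `∂_θ Φ₀ = 2ℓ(z) cos 2θ`. [folklore] -/
theorem dθ_strainMode (ℓ : ℝ → ℝ) (z θ : ℝ) :
    Elgindi.dθ (fun z θ => ℓ z * Real.sin (2 * θ)) z θ = 2 * ℓ z * Real.cos (2 * θ) := by
  unfold Elgindi.dθ
  exact (hasDerivAt_strainMode_theta ℓ z θ).deriv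

/-- `∂_θ∂_θ Φ₀ = −4ℓ(z) sin 2θ`. [folklore] -/
theorem dθ_dθ_strainMode (ℓ : ℝ → ℝ) (z θ : ℝ) :
    Elgindi.dθ (Elgindi.dθ (fun z θ => ℓ z * Real.sin (2 * θ))) z θ = -4 * ℓ z * Real.sin (2 * θ) := by
  have hfun : (fun θ' => Elgindi.dθ (fun z θ => ℓ z * Real.sin (2 * θ)) z θ') = fun θ' => 2 * ℓ z * Real.cos (2 * θ') := by
    funext θ'; exact dθ_strainMode ℓ z θ'
  show deriv (fun θ' => Elgindi.dθ (fun z θ => ℓ z * Real.sin (2 * θ)) z θ') θ = _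
  rw [hfun]
  have h := (((hasDerivAt_id' θ).const_mul (2 : ℝ)).cos).const_mul (2 * ℓ z)
  rw [h.deriv]
  ring

/-- `∂_z∂_z Φ₀ = ℓ″(z) sin 2θ` when `ℓ` is differentiable everywhere with derivative `ℓ′` and `ℓ′` has derivative `ℓ″` at `z`. [folklore] -/
theorem dz_dz_strainMode {ℓ ℓ' : ℝ → ℝ} {ℓ'' z : ℝ} (hℓ : ∀ y, HasDerivAt ℓ (ℓ' y) y) (hℓ' : HasDerivAt ℓ' ℓ'' z)
    (θ : ℝ) : Elgindi.dz (Elgindi.dz (fun z θ => ℓ z * Real.sin (2 * θ))) z θ = ℓ'' * Real.sin (2 * θ) := by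
  have hfun : (fun z' => Elgindi.dz (fun z θ => ℓ z * Real.sin (2 * θ)) z' θ) = fun z' => ℓ' z' * Real.sin (2 * θ) := by
    funext z'; exact dz_strainMode (hℓ z') θ
  show deriv (fun z' => Elgindi.dz (fun z θ => ℓ z * Real.sin (2 * θ)) z' θ) z = _
  rw [hfun]
  exact (hℓ'.mul_const _).deriv

/-! ### Trigonometric bookkeeping (`x = sin²θ`) -/

/-- `tan θ · sin 2θ = 2 sin²θ` (`cos θ ≠ 0`). [folklore] -/
theorem tan_mul_sin_two {θ : ℝ} (hc : Real.cos θ ≠ 0) :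
    Real.tan θ * Real.sin (2 * θ) = 2 * Real.sin θ ^ 2 := by
  rw [Real.tan_eq_sin_div_cos, Real.sin_two_mul, div_mul_eq_mul_div, div_eq_iff hc]
  ring

/-- `cos 2θ = 1 − 2 sin²θ`, the form used throughout. [folklore] -/
theorem cos_two_eq (θ : ℝ) : Real.cos (2 * θ) = 1 - 2 * Real.sin θ ^ 2 := by
  rw [Real.cos_two_mul, Real.cos_sq']
  ring

/-- The `θ`-slice `θ ↦ tan θ · Φ₀(z, θ)` has derivative `2ℓ(z) sin 2θ` where `cos θ ≠ 0`
(`(tan θ sin 2θ)′ = (2 sin²θ)′ = 2 sin 2θ`). [folklore] -/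
theorem hasDerivAt_tan_mul_strainMode (ℓ : ℝ → ℝ) (z : ℝ) {θ : ℝ} (hc : Real.cos θ ≠ 0) :
    HasDerivAt (fun θ' => Real.tan θ' * (ℓ z * Real.sin (2 * θ'))) (2 * ℓ z * Real.sin (2 * θ)) θ := by
  have h := (Real.hasDerivAt_tan hc).mul (hasDerivAt_strainMode_theta ℓ z θ)
  refine h.congr_deriv ?_
  rw [Real.tan_eq_sin_div_cos, Real.sin_two_mul, Real.cos_two_mul]
  field_simp
  ring

/-- `∂_θ(tan θ · Φ₀) = 2ℓ(z) sin 2θ` where `cos θ ≠ 0`. [folklore] -/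
theorem dθ_tan_mul_strainMode (ℓ : ℝ → ℝ) (z : ℝ) {θ : ℝ} (hc : Real.cos θ ≠ 0) :
    Elgindi.dθ (fun z' θ' => Real.tan θ' * (ℓ z' * Real.sin (2 * θ'))) z θ = 2 * ℓ z * Real.sin (2 * θ) := by
  unfold Elgindi.dθ
  exact (hasDerivAt_tan_mul_strainMode ℓ z hc).deriv

/-! ### The operators `U`, `V`, `𝓡` and the elliptic operator on the strain mode -/

/-- **`U(Φ₀) = −(3ℓ + αzℓ′) sin 2θ`** (`U(Φ) = −3Φ − αD_zΦ`). [new here — MODEL/Euler gauge calculus; asym/README §1] -/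
theorem opU_strainMode (α : ℝ) {ℓ : ℝ → ℝ} {ℓ' z : ℝ} (hℓ : HasDerivAt ℓ ℓ' z) (θ : ℝ) :
    Elgindi.opU α (fun z θ => ℓ z * Real.sin (2 * θ)) z θ = -(3 * ℓ z + α * (z * ℓ')) * Real.sin (2 * θ) := by
  rw [Elgindi.opU, Dz_strainMode hℓ]
  ring

/-- **`V(Φ₀) = 2ℓ(1 − 3 sin²θ)`** (`V(Φ) = ∂_θΦ − tan θ Φ`; `cos θ ≠ 0`). [new here — MODEL/Euler gauge calculus; asym/README §1] -/
theorem opV_strainMode {ℓ : ℝ → ℝ} (z : ℝ) {θ : ℝ} (hc : Real.cos θ ≠ 0) :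
    Elgindi.opV (fun z θ => ℓ z * Real.sin (2 * θ)) z θ = 2 * ℓ z * (1 - 3 * Real.sin θ ^ 2) := by
  rw [Elgindi.opV, dθ_strainMode, cos_two_eq]
  have h := tan_mul_sin_two hc
  calc 2 * ℓ z * (1 - 2 * Real.sin θ ^ 2) - Real.tan θ * (ℓ z * Real.sin (2 * θ))
      = 2 * ℓ z * (1 - 2 * Real.sin θ ^ 2) - ℓ z * (Real.tan θ * Real.sin (2 * θ)) := by ring
    _ = 2 * ℓ z * (1 - 3 * Real.sin θ ^ 2) := by rw [h]; ring

/-- **`𝓡(Φ₀) = 2ℓ + 2αzℓ′ sin²θ`** (`𝓡(Φ) = (2 sin θ Φ + α sin θ D_zΦ + cos θ ∂_θΦ)/cos θ`; `cos θ ≠ 0`): the stretching rate of the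
strain mode is `2ℓ` plus the local flux term. [new here — MODEL/Euler gauge calculus; asym/README §1] -/
theorem opR_strainMode (α : ℝ) {ℓ : ℝ → ℝ} {ℓ' z : ℝ} (hℓ : HasDerivAt ℓ ℓ' z) {θ : ℝ} (hc : Real.cos θ ≠ 0) :
    Elgindi.opR α (fun z θ => ℓ z * Real.sin (2 * θ)) z θ = 2 * ℓ z + 2 * α * (z * ℓ') * Real.sin θ ^ 2 := by
  rw [Elgindi.opR, Dz_strainMode hℓ, dθ_strainMode, div_eq_iff hc, Real.sin_two_mul, cos_two_eq]
  ring

/-- **The elliptic operator on the strain mode**: `E(Φ₀) = (−α²z²ℓ″ − α(5+α)zℓ′) sin 2θ` (`cos θ ≠ 0`). The angular part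
`−∂_θθ + ∂_θ(tan θ ·) − 6` annihilates `sin 2θ` (`4 + 2 − 6 = 0`): the mode is in the kernel of the angular operator, so its
`z`-profile `ℓ` is governed by `−α²z²ℓ″ − α(5+α)zℓ′ = (projection of F)`, whose indicial exponents in `z` are `0` and `−5/α` —
the non-decaying exponent `0` is the long-range `L₁₂` piece. [new here — MODEL/Euler gauge calculus; asym/README §1] -/
theorem ellipticOp_strainMode (α : ℝ) {ℓ ℓ' : ℝ → ℝ} {ℓ'' z : ℝ} (hℓ : ∀ y, HasDerivAt ℓ (ℓ' y) y)
    (hℓ' : HasDerivAt ℓ' ℓ'' z) {θ : ℝ} (hc : Real.cos θ ≠ 0) :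
    Elgindi.ellipticOp α (fun z θ => ℓ z * Real.sin (2 * θ)) z θ
      = (-α ^ 2 * z ^ 2 * ℓ'' - α * (5 + α) * z * ℓ' z) * Real.sin (2 * θ) := by
  rw [Elgindi.ellipticOp, dz_dz_strainMode hℓ hℓ' θ, dz_strainMode (hℓ z) θ, dθ_dθ_strainMode,
    dθ_tan_mul_strainMode ℓ z hc]
  ring

/-! ### Elgindi's class weight and the transport coefficients -/

/-- **Logarithmic derivative of the class-E weight along `sin 2θ`**: for `Γ_E = sinᵃθ cosᵇθ` with `a = α/3`, `b = 2α/3`,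
`sin 2θ · (a cos θ/sin θ − b sin θ/cos θ) = (2α/3)(1 − 3 sin²θ)` (`sin θ ≠ 0`, `cos θ ≠ 0`). [new here — MODEL/Euler gauge algebra; asym/README §1] -/
theorem weightLogDeriv_E_mul_sin_two (α : ℝ) {θ : ℝ} (hs : Real.sin θ ≠ 0) (hc : Real.cos θ ≠ 0) :
    Real.sin (2 * θ) * (α / 3 * (Real.cos θ / Real.sin θ) - 2 * α / 3 * (Real.sin θ / Real.cos θ))
      = 2 * α / 3 * (1 - 3 * Real.sin θ ^ 2) := by
  have hc2 : Real.cos θ ^ 2 = 1 - Real.sin θ ^ 2 := by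
    have := Real.sin_sq_add_cos_sq θ; linarith
  have e1 : Real.sin (2 * θ) * (Real.cos θ / Real.sin θ) = 2 * Real.cos θ ^ 2 := by
    rw [Real.sin_two_mul, mul_div_assoc', div_eq_iff hs]; ring
  have e2 : Real.sin (2 * θ) * (Real.sin θ / Real.cos θ) = 2 * Real.sin θ ^ 2 := by
    rw [Real.sin_two_mul, mul_div_assoc', div_eq_iff hc]; ring
  calc Real.sin (2 * θ) * (α / 3 * (Real.cos θ / Real.sin θ) - 2 * α / 3 * (Real.sin θ / Real.cos θ))
      = α / 3 * (Real.sin (2 * θ) * (Real.cos θ / Real.sin θ))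
          - 2 * α / 3 * (Real.sin (2 * θ) * (Real.sin θ / Real.cos θ)) := by ring
    _ = α / 3 * (2 * Real.cos θ ^ 2) - 2 * α / 3 * (2 * Real.sin θ ^ 2) := by rw [e1, e2]
    _ = 2 * α / 3 * (1 - 3 * Real.sin θ ^ 2) := by rw [hc2]; ring

/-- **Transport coefficient `a` on the strain mode** (pure algebra): `a = (1+δ) + αV₀` with `V₀ = 2ℓ(1 − 3x)` is
`(1+δ) + 2αℓ(1 − 3x)`. [new here — MODEL/Euler gauge algebra; Z6 ENGINE-B.md §D1′] -/
theorem transportCoeff_a_strainMode (δ α ℓ x : ℝ) :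
    (1 + δ) + α * (2 * ℓ * (1 - 3 * x)) = (1 + δ) + 2 * α * ℓ * (1 - 3 * x) := by
  ring

/-- **Transport coefficient `c` on the strain mode** (pure algebra, `x = sin²θ`, `m = zℓ′`): with `𝓡₀ = 2ℓ + 2αmx`,
`V₀ = 2ℓ(1−3x)`, `U₀ = −(3ℓ + αm) sin 2θ` and `sin 2θ Γ_E′/Γ_E = (2α/3)(1−3x)`, the coefficient
`c = 𝓡₀ − 1 − ((1+δ) + αV₀) − U₀Γ_E′/Γ_E` equals `(2ℓ − 2 − δ) + αm(2x + (2α/3)(1 − 3x))`: the strain's own contributions to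
stretching, radial speed and the weight's transport CANCEL identically, leaving the θ-independent defect `2ℓ − 2 − δ` plus the
local flux term. [new here — MODEL/Euler gauge algebra; asym/README §1] -/
theorem transportCoeff_c_strainMode (δ α ℓ m x : ℝ) :
    (2 * ℓ + 2 * α * m * x) - 1 - ((1 + δ) + α * (2 * ℓ * (1 - 3 * x)))
        - (-(3 * ℓ + α * m) * (2 * α / 3 * (1 - 3 * x)))
      = (2 * ℓ - 2 - δ) + α * m * (2 * x + 2 * α / 3 * (1 - 3 * x)) := by
  ring

/-- **At the corner the flux term is absent and `c` is the corner coefficient of `ElgindiGaugeCornerSpeed.corner_coeff_E`**: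
with `m = 0` and `ℓ = A`, `c = 2A − 2 − δ`. [new here — MODEL/Euler gauge algebra] -/
theorem transportCoeff_c_strainMode_corner (δ α A x : ℝ) :
    (2 * A - 2 - δ) + α * 0 * (2 * x + 2 * α / 3 * (1 - 3 * x)) = 2 * A - 2 - δ := by
  ring

/-! ### Normal form in units of `1 + δ`: `δ` enters only through `λ₀` -/

/-! The corner value of `λ = ℓ/(1+δ)` under the corner law `ℓ(0) = 1 + δ/2` is `λ₀ = (2+δ)/(2(1+δ))`, written inline below. -/

/-- `λ₀ = (2+δ)/(2(1+δ)) = (1 + ε)/2` with `ε = 1/(1+δ)` (`1 + δ ≠ 0`). [new here — MODEL/Euler gauge algebra; asym/README §1] -/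
theorem lambda0_eq (δ : ℝ) (h : 1 + δ ≠ 0) : (2 + δ) / (2 * (1 + δ)) = (1 + 1 / (1 + δ)) / 2 := by
  field_simp
  ring

/-- `(1+δ)λ₀ = 1 + δ/2 = A` (the corner law amplitude; `1 + δ ≠ 0`). [new here — MODEL/Euler gauge algebra] -/
theorem one_add_mul_lambda0 (δ : ℝ) (h : 1 + δ ≠ 0) : (1 + δ) * ((2 + δ) / (2 * (1 + δ))) = 1 + δ / 2 := by
  rw [mul_div_assoc', div_eq_iff (mul_ne_zero two_ne_zero h)]
  ring

/-- **Normal form of the transport coefficients**: with `ℓ = (1+δ)λ` and `m = (1+δ)μ`,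
`c = (1+δ)·(2(λ − λ₀) + αμ(2x + (2α/3)(1−3x)))` and `a = (1+δ)·(1 + 2αλ(1−3x))` (`1 + δ ≠ 0`). Consequently the reduced
(strain-mode) transport equation `a y_s + U₀ y_θ = c`, divided by `1+δ`, contains `δ` ONLY through the constant `λ₀`.
[new here — MODEL/Euler gauge algebra; asym/README §1] -/
theorem transportCoeff_normalForm (δ α lam μ x : ℝ) (h : 1 + δ ≠ 0) :
    (2 * ((1 + δ) * lam) - 2 - δ) + α * ((1 + δ) * μ) * (2 * x + 2 * α / 3 * (1 - 3 * x))
        = (1 + δ) * (2 * (lam - (2 + δ) / (2 * (1 + δ))) + α * μ * (2 * x + 2 * α / 3 * (1 - 3 * x)))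
      ∧ (1 + δ) + 2 * α * ((1 + δ) * lam) * (1 - 3 * x) = (1 + δ) * (1 + 2 * α * lam * (1 - 3 * x)) := by
  refine ⟨?_, by ring⟩
  field_simp
  ring

/-- **Axis corner speed in normal form**: at the axis (`x = 1`) and at the corner (`λ = λ₀`) the normalised speed
`1 + 2αλ₀(1 − 3)` is `1 − 2α(1 + 1/(1+δ))`, i.e. `m_char/(1+δ)` with `m_char = (1+δ) − 2α(2+δ)`
(`ElgindiGaugeCornerSpeed.cornerSpeed_E`; `1 + δ ≠ 0`). [new here — MODEL/Euler gauge algebra] -/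
theorem axisCornerSpeed_normalForm (δ α : ℝ) (h : 1 + δ ≠ 0) :
    1 + 2 * α * ((2 + δ) / (2 * (1 + δ))) * (1 - 3 * 1) = 1 - 2 * α * (1 + 1 / (1 + δ))
      ∧ (1 + δ) * (1 - 2 * α * (1 + 1 / (1 + δ))) = (1 + δ) - 2 * α * (2 + δ) := by
  constructor
  · field_simp; ring
  · field_simp; ring

/-- `λ₀(δ) → 1/2` as `δ → ∞`: the reduced equation has a regular formal limit in which the corner strain level is `1/2`.
[new here — MODEL/Euler gauge algebra] -/
theorem tendsto_lambda0_atTop : Tendsto (fun δ : ℝ => (2 + δ) / (2 * (1 + δ))) atTop (𝓝 (1 / 2)) := by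
  have h1 : Tendsto (fun δ : ℝ => 1 / (1 + δ)) atTop (𝓝 0) :=
    tendsto_const_nhds.div_atTop (tendsto_atTop_add_const_left atTop (1 : ℝ) tendsto_id)
  have h2 : Tendsto (fun δ : ℝ => (1 + 1 / (1 + δ)) / 2) atTop (𝓝 ((1 + 0) / 2)) :=
    (tendsto_const_nhds.add h1).div_const 2
  have h3 : (fun δ : ℝ => (1 + 1 / (1 + δ)) / 2) =ᶠ[atTop] fun δ : ℝ => (2 + δ) / (2 * (1 + δ)) := by
    filter_upwards [eventually_gt_atTop (-1 : ℝ)] with δ hδ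
    rw [lambda0_eq δ (by linarith)]
  simpa using h2.congr' h3

/-! ### The characteristic-reversal line and the wall `α = 1/2` -/

/-- **The reversal threshold is below `1/2` at every `δ > −2`**: `α_rev(δ) = (1+δ)/(2(2+δ)) < 1/2`. With
`ElgindiGaugeCornerSpeed.cornerSpeed_E_pos_iff`: a class-E profile whose axis corner is a pure INFLOW node has `α_E < 1/2`
at every finite `δ`. [new here — MODEL/Euler gauge algebra; Z6 SHEET §6.1] -/
theorem reversalLine_lt_half {δ : ℝ} (h : -2 < δ) : (1 + δ) / (2 * (2 + δ)) < 1 / 2 := by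
  rw [div_lt_div_iff₀ (by linarith) (by norm_num)]
  linarith

/-- **The reversal margin in the census variable** `C = (1+δ)(1/2 − α)`: on the reversal line
`(1+δ)(1/2 − α_rev(δ)) = (1+δ)/(2(2+δ))` (`2 + δ ≠ 0`) — so a branch with `(1+δ)(1/2 − α_E) → C₀ > 1/2` keeps its corner speed
`m_char = (1+δ) − 2α_E(2+δ) = 2C − 2α_E → 2C₀ − 1 > 0`. [new here — MODEL/Euler gauge algebra; asym/README §3] -/
theorem reversalMargin_eq (δ : ℝ) (h : 2 + δ ≠ 0) :
    (1 + δ) * (1 / 2 - (1 + δ) / (2 * (2 + δ))) = (1 + δ) / (2 * (2 + δ))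
      ∧ ∀ α : ℝ, (1 + δ) - 2 * α * (2 + δ) = 2 * ((1 + δ) * (1 / 2 - α)) - 2 * α := by
  refine ⟨?_, fun α => by ring⟩
  field_simp
  ring

/-- **The reversal line meets the wall only at `δ = ∞`**: `α_rev(δ) = (1+δ)/(2(2+δ)) → 1/2` as `δ → ∞`.
[new here — MODEL/Euler gauge algebra] -/
theorem tendsto_reversalLine_atTop : Tendsto (fun δ : ℝ => (1 + δ) / (2 * (2 + δ))) atTop (𝓝 (1 / 2)) := by
  have h1 : Tendsto (fun δ : ℝ => 1 / (2 + δ)) atTop (𝓝 0) :=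
    tendsto_const_nhds.div_atTop (tendsto_atTop_add_const_left atTop (2 : ℝ) tendsto_id)
  have h2 : Tendsto (fun δ : ℝ => (1 - 1 / (2 + δ)) / 2) atTop (𝓝 ((1 - 0) / 2)) :=
    (tendsto_const_nhds.sub h1).div_const 2
  have h3 : (fun δ : ℝ => (1 - 1 / (2 + δ)) / 2) =ᶠ[atTop] fun δ => (1 + δ) / (2 * (2 + δ)) := by
    filter_upwards [eventually_gt_atTop (-2 : ℝ)] with δ hδ
    have : 2 + δ ≠ 0 := by linarith
    field_simp
    ring
  simpa using h2.congr' h3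

/-- **Drain-phase exponent** (asym/README §4): if `(ln H)_s = −1/(2α)` then the class-E profile `F = Γ z H ∝ Γ z^{1 − 1/(2α)}`,
and the exponent `1 − 1/(2α)` vanishes iff `α = 1/2` — the large-`δ` profile tends to a `z`-flat angular front exactly at the
wall. [new here — MODEL/Euler gauge algebra] -/
theorem drainExponent_eq_zero_iff {α : ℝ} (hα : α ≠ 0) : 1 - 1 / (2 * α) = 0 ↔ α = 1 / 2 := by
  constructor
  · intro h
    field_simp at h
    linarith
  · rintro rfl
    norm_num

/-! ### The axis slope law of the reduced equation (appended 2026-08-27, eng-10 g5; asym/LIMIT-ANALYSIS.md §2)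

On the axis (`x = 1`, no angular transport) the reduced equation reads `y′ = c̃/ã` with `ã = 1 − 4αλ` and, dropping the local flux
term, `c̃ = 2(λ − λ₀)`; writing `Λ = λ₀ − λ` for the drained mass, `1 − 4αλ = m̃ + 4αΛ` with `m̃ = 1 − 4αλ₀` the (normalised)
corner speed, so the axis slope is `−2Λ/(m̃ + 4αΛ)`: `0` at the corner, `→ −1/(2α)` once `Λ ≫ m̃` (the «drain» slope; the reduced
numerics of zone Z6 follow it to 4 digits), and `−2λ₀ = −(1 + 1/(1+δ))` in the far tail `λ = 0` (so `F = Γ z H ∝ z^{−1/(1+δ)}`,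
the registered far-field law). Pure algebra / one elementary limit; MODEL (Euler); nothing about solutions. -/

/-- **Axis denominator**: `1 − 4αλ = (1 − 4αλ₀) + 4α(λ₀ − λ)` — the axis speed is the corner speed `m̃` plus `4α` times the
drained mass. [new here — MODEL/Euler gauge algebra; asym/LIMIT-ANALYSIS §2] -/
theorem axisDenominator_eq (α lam lam0 : ℝ) : 1 - 4 * α * lam = (1 - 4 * α * lam0) + 4 * α * (lam0 - lam) := by
  ring

/-- **Axis slope in drained-mass form**: `2(λ − λ₀)/(1 − 4αλ) = −2Λ/(m̃ + 4αΛ)` with `Λ = λ₀ − λ`, `m̃ = 1 − 4αλ₀`.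
[new here — MODEL/Euler gauge algebra; asym/LIMIT-ANALYSIS §2] -/
theorem axisSlope_eq (α lam lam0 : ℝ) :
    2 * (lam - lam0) / (1 - 4 * α * lam) = -(2 * (lam0 - lam)) / ((1 - 4 * α * lam0) + 4 * α * (lam0 - lam)) := by
  rw [← axisDenominator_eq α lam lam0]
  ring

/-- **Far-tail slope**: at `λ = 0` with `λ₀ = (2+δ)/(2(1+δ))` the axis slope is `−(1 + 1/(1+δ))`, hence
`1 + slope = −1/(1+δ)`: `F = Γ z H` decays like `z^{−1/(1+δ)}` (`1 + δ ≠ 0`). [new here — MODEL/Euler gauge algebra; asym/LIMIT-ANALYSIS §2] -/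
theorem axisSlope_tail (α δ : ℝ) (h : 1 + δ ≠ 0) :
    2 * (0 - (2 + δ) / (2 * (1 + δ))) / (1 - 4 * α * 0) = -(1 + 1 / (1 + δ))
      ∧ 1 + -(1 + 1 / (1 + δ)) = -(1 / (1 + δ)) := by
  constructor
  · field_simp
    ring
  · ring

/-- **Drain slope**: for `α ≠ 0` the axis slope `−2Λ/(m̃ + 4αΛ)` tends to `−1/(2α)` as the drained mass `Λ → ∞` relative to
`m̃` (stated as `Λ → ∞` at fixed `m̃`; by homogeneity only `Λ/m̃` matters). At `α = 1/2` the drain slope is `−1`: `F = Γ z H` is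
`z`-flat on the draining plateau (`drainExponent_eq_zero_iff`). [new here — MODEL/Euler gauge calculus; asym/LIMIT-ANALYSIS §2] -/
theorem tendsto_axisSlope_atTop {α : ℝ} (hα : α ≠ 0) (m : ℝ) :
    Tendsto (fun L : ℝ => -(2 * L) / (m + 4 * α * L)) atTop (𝓝 (-(1 / (2 * α)))) := by
  have h1 : Tendsto (fun L : ℝ => m / L) atTop (𝓝 0) := tendsto_const_nhds.div_atTop tendsto_id
  have h2 : Tendsto (fun L : ℝ => -2 / (m / L + 4 * α)) atTop (𝓝 (-2 / (0 + 4 * α))) :=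
    tendsto_const_nhds.div (h1.add tendsto_const_nhds) (by simpa using hα)
  have h3 : (fun L : ℝ => -2 / (m / L + 4 * α)) =ᶠ[atTop] fun L : ℝ => -(2 * L) / (m + 4 * α * L) := by
    filter_upwards [eventually_gt_atTop (0 : ℝ)] with L hL
    rw [div_add' _ _ _ hL.ne', div_div_eq_mul_div, neg_mul]
  have : (-2 / (0 + 4 * α) : ℝ) = -(1 / (2 * α)) := by
    field_simp
    ring
  rw [← this]
  exact h2.congr' h3

/-! ### Which homogeneous angular weights balance the strain mode EXACTLY (appended 2026-08-27, eng-10 g5; eng-9 g2's outer law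
HOME/profile/z6/pen/LARGE-DELTA-STRUCTURE.md §2 in kernel form)

For a homogeneous weight `Γ = sinᵃθ cosᵇθ` carried by `z^q` with `qα = a + b` (so that `ρ^{qα}Γ = x₃ᵃ rᵇ`), the transport coefficient of
`F = Γ z^q H` against the strain mode at level `A` (flux term dropped) is `c = 𝓡₀ − 1 − q(1+δ) − qαV₀ − U₀Γ′/Γ` with `𝓡₀ = 2A`,
`V₀ = 2A(1−3x)`, `U₀Γ′/Γ = −6A(a(1−x) − bx)` (`ElgindiGaugeCornerSpeed.corner_coeff_theta_terms`), i.e. `c = A(2 + 4a − 2b) − 1 − q(1+δ)`.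
The `O(A)` part — the only part that is large when `A ~ (1+δ)/2 → ∞` — vanishes identically iff `b = 1 + 2a`. Two members matter for
zone Z6: the `z`-flat one (`q = 0`, hence `a + b = 0`): `a = −1/3`, `b = 1/3`, i.e. `F ∝ (cot θ)^{1/3}`, `c = −1` — eng-9 g2's
plane-side OUTER LAW of the large-δ Elgindi branch («−6aF_u = 2aF»); and Elgindi's class E (`q = 1`, `a = α/3`, `b = 2α/3`), for which
the `O(A)` part is `2A ≠ 0` and is cancelled instead by `−1 − (1+δ)` through the corner law `A = 1 + δ/2`. The outer law's axis order
`1/3` equals the class-E axis order `2α/3` iff `α = 1/2` (`outerLaw_axisOrder_eq_classE_iff`) — the one-line form of the reading «the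
branch can only end at the wall α_E = 1/2». Pure algebra; MODEL (Euler); nothing about solutions. -/

/-- **Strain-mode transport coefficient for a homogeneous weight** `sinᵃθ cosᵇθ z^q`, `qα = a + b` (flux term dropped):
`(2A − 1 − q(1+δ)) − qα·2A(1−3x) + 6A(a(1−x) − bx) = A(2 + 4a − 2b) − 1 − q(1+δ)`, independently of `x = sin²θ`.
[new here — MODEL/Euler gauge algebra; LARGE-DELTA-STRUCTURE §2 / asym/LIMIT-ANALYSIS] -/
theorem strainCoeff_homogeneous (A δ q α a b x : ℝ) (h : q * α = a + b) :
    (2 * A - 1 - q * (1 + δ)) - q * α * (2 * A * (1 - 3 * x)) + 6 * A * (a * (1 - x) - b * x)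
      = A * (2 + 4 * a - 2 * b) - 1 - q * (1 + δ) := by
  linear_combination (A * (6 * x - 2)) * h

/-- **The `O(A)` part vanishes identically iff `b = 1 + 2a`.** [new here — MODEL/Euler gauge algebra; LARGE-DELTA-STRUCTURE §2] -/
theorem strainCoeff_leading_eq_zero_iff (a b : ℝ) : (∀ A : ℝ, A * (2 + 4 * a - 2 * b) = 0) ↔ b = 1 + 2 * a := by
  constructor
  · intro hA
    have h1 := hA 1
    linarith
  · intro hb A
    rw [hb]
    ring

/-- **The z-flat exact balance is `(cot θ)^{1/3}`**: `q = 0` (so `a + b = 0·α = 0`) together with `b = 1 + 2a` forces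
`a = −1/3`, `b = 1/3`, and then `c = −1` (only the `O(1)` term `−1` of the profile equation survives) — eng-9 g2's outer law
`F ∝ e^{−u/3} = (cot θ)^{1/3}` of the large-δ Elgindi branch. [new here — MODEL/Euler gauge algebra; LARGE-DELTA-STRUCTURE §2] -/
theorem outerLaw_exponents {a b : ℝ} (hq : a + b = 0) (hb : b = 1 + 2 * a) :
    a = -(1 / 3) ∧ b = 1 / 3 ∧ ∀ A δ : ℝ, A * (2 + 4 * a - 2 * b) - 1 - 0 * (1 + δ) = -1 := by
  refine ⟨by linarith, by linarith, fun A δ => ?_⟩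
  rw [hb]
  ring

/-- **Class E is NOT in the exactly-balanced family**: with `a = α/3`, `b = 2α/3`, `q = 1` the `O(A)` part is `2A` and the
coefficient is `2A − 2 − δ` (`ElgindiGaugeCornerSpeed.corner_coeff_E`): it vanishes at the corner only through the corner law
`A = 1 + δ/2`, i.e. by balancing the large strain level against the large `δ`. [new here — MODEL/Euler gauge algebra] -/
theorem strainCoeff_classE (A δ α : ℝ) :
    A * (2 + 4 * (α / 3) - 2 * (2 * α / 3)) - 1 - 1 * (1 + δ) = 2 * A - 2 - δ := by
  ring

/-- **Axis orders match iff `α = 1/2`**: the outer law's axis order `1/3` (the power of `cos θ` in `(cot θ)^{1/3}`) equals the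
class-E axis order `2α/3` iff `α = 1/2` — eng-9 g2's reading «the coexistence of the class-E axis structure with the large-δ
strain–stretching balance forces α_E → 1/2» in one line. [new here — MODEL/Euler gauge algebra; LARGE-DELTA-STRUCTURE §2] -/
theorem outerLaw_axisOrder_eq_classE_iff (α : ℝ) : 2 * α / 3 = 1 / 3 ↔ α = 1 / 2 := by
  constructor <;> intro h <;> linarith

end ElgindiStrainMode
end Summit.NavierStokesRegularity.OSWSelfSimilar
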